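import Mathlib
import HarnessLib
import Literature.Probability.MarkovChains.MetropolisHastings

/-!
# Tempered transitions through a protocol are exact: detailed balance of Neal's round-trip kernel

HONEST FRAMING: exact (Metropolis-corrected) sampling algorithms for lattice gauge theory;
figures of merit are autocorrelation/cost numbers at stated couplings and volumes; no
continuum-physics claim.

Venture `LatticeQCDFlow` (cell pub-lqcd), topic `Exactness`; FANOUT row 13 (`eng-snf`, the SNF /
non-equilibrium-MCMC protocol engine `latflow-snf`, module `snf.tempered`).  NEW WORK of the cell
(an elementary finite-sum proof), not a published result: the construction is R. M. Neal,
"Sampling from multimodal distributions using tempered transitions", Statistics and Computing 6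
(1996) 353–366, §3 (named in docstrings only; nothing is cited as a fact).

## Content

Levels `0, …, N` carry actions `S 0, …, S N : X → ℝ` on a finite configuration space (`S 0` the
TARGET, e.g. periodic boundary conditions; `S N` the top, e.g. an open defect where the
topological charge moves freely).  Level `i.succ` has an UP kernel `T i` and a DOWN kernel
`Tadj i` which are MUTUALLY REVERSIBLE for `e^{-S i.succ}` (`MutuallyReversible`; for a
reversible kernel `Tadj i = T i`; for a deterministic-scan sweep `Tadj i` is the sweep in the
reverse order — `snf`'s `sweep(direction = -1)`).  A tempered transition from the current target
state `x` draws an up-path `u` (`u 0 = x`, `u (i+1) ∼ T i (u i, ·)`), then a down-path `d` from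
the top (`d N = u N`, `d i ∼ Tadj i (d (i+1), ·)`), and accepts the candidate `d 0` with
probability `min 1 (e^{-W})`, `W = roundTripWork S u d = Σ_i [S (i+1) (u i) - S i (u i)] -
Σ_i [S (i+1) (d i) - S i (d i)]` (the Jarzynski work of the round trip, i.e. `work S u - work S d`
in the notation of `JarzynskiFinite.lean`; all partition functions cancel).

* `roundTrip_pathwise` — the pathwise identity
  `e^{-S 0 (u 0)} · up(u) · down(d) · e^{-W(u,d)} = e^{-S 0 (d 0)} · up(d) · down(u)` whenever
  `u N = d N`: the reversed round trip is the SAME pair with the roles of `u` and `d` swapped;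
* `temperedMove_detailedBalance` — the accepted-move weights
  `M x x' = Σ_{u 0 = x, d 0 = x', u N = d N} up(u) down(d) min(1, e^{-W})` satisfy
  `e^{-S 0 x} M x x' = e^{-S 0 x'} M x' x` for ALL `N`, `S`, `T`, `Tadj` (non-negative kernels);
* `temperedKernel_detailedBalance`, `temperedKernel_isStationary` — adding the rejection mass on
  the diagonal gives a kernel in detailed balance with, hence leaving invariant, `e^{-S 0}`:
  the tempered-transition chain samples the target EXACTLY whatever the protocol length, the
  number of sweeps per level or their mixing (these only set the acceptance rate).

Dictionary: `X` = a finite discretisation of the gauge-field configuration space; `S i` =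
the interpolating lattice actions of a boundary-condition / defect protocol read from the target
end; `T i` / `Tadj i` = heat-bath(+over-relaxation) sweeps and their reverse-order sweeps.  This is
the `correction = tempered-transitions` ("NCMC-Metropolization") mode of `latflow-snf`, the exact
Markov-chain alternative to Jarzynski reweighting (`JarzynskiFinite.lean`).
-/

namespace Summit.Ventures.LatticeQCDFlow.Exactness

open Finset
open Literature.Probability.MarkovChains

variable {X : Type*} [Fintype X]

/-! ## Round-trip objects -/

/-- Mutual reversibility of an up-kernel `T` and a down-kernel `Tadj` with respect to a weight
`π` (Neal 1996 §3): `π a · T a b = π b · Tadj b a` for all `a, b`.  With `Tadj = T` this is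
`DetailedBalance π T`; the reverse-order sweep of a sequential heat-bath sweep is the standard
non-trivial example.  A standard notion (the adjoint kernel w.r.t. `π`), no single source.
[folklore] -/
@[folklore]
def MutuallyReversible (π : X → ℝ) (T Tadj : X → X → ℝ) : Prop :=
  ∀ a b, π a * T a b = π b * Tadj b a

omit [Fintype X] in
/-- A reversible kernel is mutually reversible with itself. -/
theorem DetailedBalance.mutuallyReversible {π : X → ℝ} {T : X → X → ℝ}
    (h : DetailedBalance π T) : MutuallyReversible π T T := h

/-- Probability of the UP path `u 0 → u 1 → ⋯ → u N`: `Π_{i<N} T i (u i) (u (i+1))`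
(`T i` is the up-kernel of level `i+1`).  Equal to `transProb T u`. -/
noncomputable def upProb {N : ℕ} (T : Fin N → X → X → ℝ) (u : Fin (N + 1) → X) : ℝ :=
  ∏ i : Fin N, T i (u i.castSucc) (u i.succ)

/-- Probability of the DOWN path `d N → d (N-1) → ⋯ → d 0`: `Π_{i<N} Tadj i (d (i+1)) (d i)`
(`Tadj i` is the down-kernel of level `i+1`; `d 0` is the candidate end state). -/
noncomputable def downProb {N : ℕ} (Tadj : Fin N → X → X → ℝ) (d : Fin (N + 1) → X) : ℝ :=
  ∏ i : Fin N, Tadj i (d i.succ) (d i.castSucc)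

omit [Fintype X] in
/-- Peeling the first up-step off `upProb`. -/
theorem upProb_cons {N : ℕ} (T : Fin (N + 1) → X → X → ℝ) (u₀ : X) (u : Fin (N + 1) → X) :
    upProb T (Fin.cons u₀ u : Fin (N + 2) → X) = T 0 u₀ (u 0) * upProb (fun i => T i.succ) u := by
  unfold upProb
  rw [Fin.prod_univ_succ]
  simp only [Fin.castSucc_zero, Fin.cons_zero, Fin.cons_succ, Fin.castSucc_succ]

omit [Fintype X] in
/-- Peeling the first level off `downProb` (the LAST down-step in time). -/
theorem downProb_cons {N : ℕ} (Tadj : Fin (N + 1) → X → X → ℝ) (d₀ : X) (d : Fin (N + 1) → X) :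
    downProb Tadj (Fin.cons d₀ d : Fin (N + 2) → X) =
      Tadj 0 (d 0) d₀ * downProb (fun i => Tadj i.succ) d := by
  unfold downProb
  rw [Fin.prod_univ_succ]
  simp only [Fin.castSucc_zero, Fin.cons_zero, Fin.cons_succ, Fin.castSucc_succ]

/-- WORK of the round trip `(u, d)`: the up-path pays `S (i+1) (u i) - S i (u i)` at each switch,
the down-path pays `S i (d i) - S (i+1) (d i)`; in the notation of `JarzynskiFinite.lean` this is
`work S u - work S d`. -/
noncomputable def roundTripWork {N : ℕ} (S : Fin (N + 1) → X → ℝ) (u d : Fin (N + 1) → X) : ℝ :=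
  ∑ i : Fin N, (S i.succ (u i.castSucc) - S i.castSucc (u i.castSucc)) -
    ∑ i : Fin N, (S i.succ (d i.castSucc) - S i.castSucc (d i.castSucc))

omit [Fintype X] in
/-- Peeling the level-`0 ↔ 1` switches off the round-trip work. -/
theorem roundTripWork_cons {N : ℕ} (S : Fin (N + 2) → X → ℝ) (u₀ d₀ : X) (u d : Fin (N + 1) → X) :
    roundTripWork S (Fin.cons u₀ u : Fin (N + 2) → X) (Fin.cons d₀ d : Fin (N + 2) → X) =
      (S 1 u₀ - S 0 u₀) - (S 1 d₀ - S 0 d₀) + roundTripWork (fun k => S k.succ) u d := by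
  unfold roundTripWork
  rw [Fin.sum_univ_succ, Fin.sum_univ_succ]
  simp only [Fin.castSucc_zero, Fin.cons_zero, Fin.cons_succ, Fin.castSucc_succ,
    Fin.succ_zero_eq_one]
  ring

omit [Fintype X] in
/-- Swapping the up- and down-paths (time reversal of the round trip) flips the sign of the work. -/
theorem roundTripWork_swap {N : ℕ} (S : Fin (N + 1) → X → ℝ) (u d : Fin (N + 1) → X) :
    roundTripWork S d u = -roundTripWork S u d := by
  unfold roundTripWork
  ring

omit [Fintype X] in
/-- Up-path probabilities are non-negative for non-negative kernels. -/
theorem upProb_nonneg {N : ℕ} {T : Fin N → X → X → ℝ} (hT : ∀ i a b, 0 ≤ T i a b)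
    (u : Fin (N + 1) → X) : 0 ≤ upProb T u :=
  prod_nonneg fun i _ => hT i _ _

omit [Fintype X] in
/-- Down-path probabilities are non-negative for non-negative kernels. -/
theorem downProb_nonneg {N : ℕ} {Tadj : Fin N → X → X → ℝ} (hT : ∀ i a b, 0 ≤ Tadj i a b)
    (d : Fin (N + 1) → X) : 0 ≤ downProb Tadj d :=
  prod_nonneg fun i _ => hT i _ _

/-! ## The pathwise round-trip identity -/

omit [Fintype X] in
/-- **Pathwise identity of the round trip.**  If every level's up/down kernels are mutually
reversible for its Boltzmann weight and the two paths meet at the top (`u N = d N`), then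
`e^{-S 0 (u 0)} · up(u) · down(d) · e^{-W(u,d)} = e^{-S 0 (d 0)} · up(d) · down(u)`:
the time reversal of the round trip `(u, d)` is the round trip `(d, u)`, and the work changes
sign.  (Neal 1996 §3, the computation behind his eq. (10); all normalisations cancel.) -/
theorem roundTrip_pathwise : ∀ {N : ℕ} (S : Fin (N + 1) → X → ℝ) (T Tadj : Fin N → X → X → ℝ),
    (∀ i : Fin N, MutuallyReversible (fun x => Real.exp (-S i.succ x)) (T i) (Tadj i)) →
    ∀ (u d : Fin (N + 1) → X), u (Fin.last N) = d (Fin.last N) →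
      Real.exp (-S 0 (u 0)) * upProb T u * downProb Tadj d * Real.exp (-roundTripWork S u d) =
        Real.exp (-S 0 (d 0)) * upProb T d * downProb Tadj u
  | 0, S, T, Tadj, _, u, d, htop => by
    have h0 : u 0 = d 0 := htop
    simp [upProb, downProb, roundTripWork, h0]
  | N + 1, S, T, Tadj, hrev, u, d, htop => by
    -- peel the first step of both paths
    obtain ⟨u₀, u', rfl⟩ : ∃ u₀ u', u = Fin.cons u₀ u' := ⟨u 0, Fin.tail u, (Fin.cons_self_tail u).symm⟩
    obtain ⟨d₀, d', rfl⟩ : ∃ d₀ d', d = Fin.cons d₀ d' := ⟨d 0, Fin.tail d, (Fin.cons_self_tail d).symm⟩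
    have htop' : u' (Fin.last N) = d' (Fin.last N) := by
      simpa only [← Fin.succ_last, Fin.cons_succ] using htop
    have ih := roundTrip_pathwise (N := N) (fun k => S k.succ) (fun i => T i.succ) (fun i => Tadj i.succ)
      (fun i => hrev i.succ) u' d' htop'
    simp only [Fin.succ_zero_eq_one] at ih
    rw [upProb_cons, upProb_cons, downProb_cons, downProb_cons, roundTripWork_cons, Fin.cons_zero,
      Fin.cons_zero]
    -- reversibility at level 1 for the first up-step of `u` and the last down-step of `d`
    have hu := hrev 0 u₀ (u' 0)          -- e^{-S 1 u₀} T 0 u₀ (u' 0) = e^{-S 1 (u' 0)} Tadj 0 (u' 0) u₀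
    have hd := hrev 0 d₀ (d' 0)          -- e^{-S 1 d₀} T 0 d₀ (d' 0) = e^{-S 1 (d' 0)} Tadj 0 (d' 0) d₀
    simp only [Fin.succ_zero_eq_one] at hu hd
    -- abbreviations
    set A := upProb (fun i => T i.succ) u' with hA
    set B := downProb (fun i => Tadj i.succ) d' with hB
    set A' := upProb (fun i => T i.succ) d' with hA'
    set B' := downProb (fun i => Tadj i.succ) u' with hB'
    set w := roundTripWork (fun k => S k.succ) u' d' with hw
    -- exponential bookkeeping
    have e1 : Real.exp (-S 0 u₀) * Real.exp (-((S 1 u₀ - S 0 u₀) - (S 1 d₀ - S 0 d₀) + w)) =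
        Real.exp (-S 1 u₀) * Real.exp (S 1 d₀) * Real.exp (-S 0 d₀) * Real.exp (-w) := by
      rw [← Real.exp_add, ← Real.exp_add, ← Real.exp_add, ← Real.exp_add]
      congr 1
      ring
    have e2 : Real.exp (-S 1 (u' 0)) * Real.exp (S 1 (u' 0)) = 1 := by
      rw [← Real.exp_add]; simp
    have e3 : Real.exp (-S 1 (d' 0)) * Real.exp (S 1 (d' 0)) = 1 := by
      rw [← Real.exp_add]; simp
    have e4 : Real.exp (-S 1 d₀) * Real.exp (S 1 d₀) = 1 := by
      rw [← Real.exp_add]; simp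
    -- the induction hypothesis in product form: e^{-S1 (u'0)} A B e^{-w} = e^{-S1 (d'0)} A' B'
    calc Real.exp (-S 0 u₀) * (T 0 u₀ (u' 0) * A) * (Tadj 0 (d' 0) d₀ * B) *
          Real.exp (-((S 1 u₀ - S 0 u₀) - (S 1 d₀ - S 0 d₀) + w))
        = (Real.exp (-S 1 u₀) * T 0 u₀ (u' 0)) * (Tadj 0 (d' 0) d₀ * Real.exp (S 1 d₀)) *
            Real.exp (-S 0 d₀) * (A * B * Real.exp (-w)) := by
          calc _ = (Real.exp (-S 0 u₀) * Real.exp (-((S 1 u₀ - S 0 u₀) - (S 1 d₀ - S 0 d₀) + w))) *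
                    (T 0 u₀ (u' 0) * Tadj 0 (d' 0) d₀) * (A * B) := by ring
            _ = (Real.exp (-S 1 u₀) * Real.exp (S 1 d₀) * Real.exp (-S 0 d₀) * Real.exp (-w)) *
                    (T 0 u₀ (u' 0) * Tadj 0 (d' 0) d₀) * (A * B) := by rw [e1]
            _ = _ := by ring
      _ = (Real.exp (-S 1 (u' 0)) * Tadj 0 (u' 0) u₀) * (Tadj 0 (d' 0) d₀ * Real.exp (S 1 d₀)) *
            Real.exp (-S 0 d₀) * (A * B * Real.exp (-w)) := by rw [hu]
      _ = Tadj 0 (u' 0) u₀ * (Tadj 0 (d' 0) d₀ * Real.exp (S 1 d₀)) * Real.exp (-S 0 d₀) *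
            (Real.exp (-S 1 (u' 0)) * A * B * Real.exp (-w)) := by ring
      _ = Tadj 0 (u' 0) u₀ * (Tadj 0 (d' 0) d₀ * Real.exp (S 1 d₀)) * Real.exp (-S 0 d₀) *
            (Real.exp (-S 1 (d' 0)) * A' * B') := by rw [ih]
      _ = Tadj 0 (u' 0) u₀ * B' * Real.exp (-S 0 d₀) * A' *
            ((Real.exp (-S 1 (d' 0)) * Tadj 0 (d' 0) d₀) * Real.exp (S 1 d₀)) := by ring
      _ = Tadj 0 (u' 0) u₀ * B' * Real.exp (-S 0 d₀) * A' *
            ((Real.exp (-S 1 d₀) * T 0 d₀ (d' 0)) * Real.exp (S 1 d₀)) := by rw [hd]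
      _ = Tadj 0 (u' 0) u₀ * B' * Real.exp (-S 0 d₀) * A' * T 0 d₀ (d' 0) *
            (Real.exp (-S 1 d₀) * Real.exp (S 1 d₀)) := by ring
      _ = Real.exp (-S 0 d₀) * (T 0 d₀ (d' 0) * A') * (Tadj 0 (u' 0) u₀ * B') := by rw [e4]; ring

/-! ## Detailed balance of the tempered-transition kernel -/

section Kernel

variable [DecidableEq X]

/-- Accepted-move weight of a tempered transition from `x` to the candidate `x'`:
the total probability, over up-paths from `x` and down-paths to `x'` meeting at the top, of
proposing that round trip AND accepting it with the Metropolis probability `min 1 e^{-W}`. -/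
noncomputable def temperedMove {N : ℕ} (S : Fin (N + 1) → X → ℝ) (T Tadj : Fin N → X → X → ℝ)
    (x x' : X) : ℝ :=
  ∑ u : Fin (N + 1) → X, ∑ d : Fin (N + 1) → X,
    if u 0 = x ∧ d 0 = x' ∧ u (Fin.last N) = d (Fin.last N) then
      upProb T u * downProb Tadj d * min 1 (Real.exp (-roundTripWork S u d)) else 0

/-- **Detailed balance of tempered transitions (accepted moves).**  For every protocol `S`,
every family of non-negative up/down kernels mutually reversible for the intermediate weights,
and all `x, x'`: `e^{-S 0 x} · M x x' = e^{-S 0 x'} · M x' x`.  Proof: pair the round trip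
`(u, d)` with `(d, u)` and use `roundTrip_pathwise` inside `min`. -/
theorem temperedMove_detailedBalance {N : ℕ} (S : Fin (N + 1) → X → ℝ) (T Tadj : Fin N → X → X → ℝ)
    (hT : ∀ i a b, 0 ≤ T i a b) (hTadj : ∀ i a b, 0 ≤ Tadj i a b)
    (hrev : ∀ i : Fin N, MutuallyReversible (fun x => Real.exp (-S i.succ x)) (T i) (Tadj i)) :
    DetailedBalance (fun x => Real.exp (-S 0 x)) (temperedMove S T Tadj) := by
  intro x x'
  simp only [temperedMove, mul_sum]
  conv_rhs => rw [sum_comm]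
  refine sum_congr rfl fun u _ => sum_congr rfl fun d _ => ?_
  by_cases h : u 0 = x ∧ d 0 = x' ∧ u (Fin.last N) = d (Fin.last N)
  · obtain ⟨hu, hd, htop⟩ := h
    have h' : d 0 = x' ∧ u 0 = x ∧ d (Fin.last N) = u (Fin.last N) := ⟨hd, hu, htop.symm⟩
    rw [if_pos ⟨hu, hd, htop⟩, if_pos h']
    have key := roundTrip_pathwise S T Tadj hrev u d htop
    have hA : 0 ≤ Real.exp (-S 0 (u 0)) * upProb T u * downProb Tadj d :=
      mul_nonneg (mul_nonneg (Real.exp_pos _).le (upProb_nonneg hT u)) (downProb_nonneg hTadj d)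
    have hB : 0 ≤ Real.exp (-S 0 (d 0)) * upProb T d * downProb Tadj u :=
      mul_nonneg (mul_nonneg (Real.exp_pos _).le (upProb_nonneg hT d)) (downProb_nonneg hTadj u)
    have hW : Real.exp (-roundTripWork S d u) = (Real.exp (-roundTripWork S u d))⁻¹ := by
      rw [← Real.exp_neg, roundTripWork_swap, neg_neg]
    rw [← hu, ← hd]
    calc Real.exp (-S 0 (u 0)) * (upProb T u * downProb Tadj d * min 1 (Real.exp (-roundTripWork S u d)))
        = (Real.exp (-S 0 (u 0)) * upProb T u * downProb Tadj d) *
            min 1 (Real.exp (-roundTripWork S u d)) := by ring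
      _ = min (Real.exp (-S 0 (u 0)) * upProb T u * downProb Tadj d)
            (Real.exp (-S 0 (d 0)) * upProb T d * downProb Tadj u) := by
          rw [mul_min_of_nonneg _ _ hA, mul_one, key]
      _ = min (Real.exp (-S 0 (d 0)) * upProb T d * downProb Tadj u)
            ((Real.exp (-S 0 (d 0)) * upProb T d * downProb Tadj u) * Real.exp (-roundTripWork S d u)) := by
          rw [min_comm, hW, ← key, mul_assoc (Real.exp (-S 0 (u 0)) * upProb T u * downProb Tadj d),
            mul_inv_cancel₀ (Real.exp_pos _).ne', mul_one]
      _ = (Real.exp (-S 0 (d 0)) * upProb T d * downProb Tadj u) *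
            min 1 (Real.exp (-roundTripWork S d u)) := by
          rw [mul_min_of_nonneg _ _ hB, mul_one]
      _ = Real.exp (-S 0 (d 0)) * (upProb T d * downProb Tadj u * min 1 (Real.exp (-roundTripWork S d u))) := by
          ring
  · have h' : ¬(d 0 = x' ∧ u 0 = x ∧ d (Fin.last N) = u (Fin.last N)) := by
      rintro ⟨hd, hu, htop⟩; exact h ⟨hu, hd, htop.symm⟩
    rw [if_neg h, if_neg h', mul_zero, mul_zero]

/-- The full tempered-transition kernel: accepted moves plus the rejection / no-move mass on the
diagonal, `K x x' = M x x' + [x' = x] (1 - Σ_y M x y)`. -/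
noncomputable def temperedKernel {N : ℕ} (S : Fin (N + 1) → X → ℝ) (T Tadj : Fin N → X → X → ℝ)
    (x x' : X) : ℝ :=
  temperedMove S T Tadj x x' + if x' = x then 1 - ∑ y, temperedMove S T Tadj x y else 0

/-- **Exactness of tempered transitions (E-class statement of the venture, chain mode of
`latflow-snf`).**  The tempered-transition kernel is in detailed balance with the target
Boltzmann weight `e^{-S 0}` — for ANY number of levels, ANY interpolating actions and ANY
non-negative up/down kernels that are mutually reversible level by level. -/
theorem temperedKernel_detailedBalance {N : ℕ} (S : Fin (N + 1) → X → ℝ)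
    (T Tadj : Fin N → X → X → ℝ) (hT : ∀ i a b, 0 ≤ T i a b) (hTadj : ∀ i a b, 0 ≤ Tadj i a b)
    (hrev : ∀ i : Fin N, MutuallyReversible (fun x => Real.exp (-S i.succ x)) (T i) (Tadj i)) :
    DetailedBalance (fun x => Real.exp (-S 0 x)) (temperedKernel S T Tadj) := by
  intro x x'
  unfold temperedKernel
  have hM := temperedMove_detailedBalance S T Tadj hT hTadj hrev x x'
  by_cases hxx : x' = x
  · subst hxx
    rfl
  · have hxx' : ¬x = x' := fun h => hxx h.symm
    rw [if_neg hxx, if_neg hxx', add_zero, add_zero]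
    exact hM

/-- The rows of the tempered-transition kernel sum to one (it is a Markov kernel as soon as the
accepted-move mass is at most one, which holds when the `T i`, `Tadj i` are stochastic). -/
theorem temperedKernel_sum_eq_one {N : ℕ} (S : Fin (N + 1) → X → ℝ) (T Tadj : Fin N → X → X → ℝ)
    (x : X) : ∑ x', temperedKernel S T Tadj x x' = 1 := by
  unfold temperedKernel
  rw [sum_add_distrib, sum_ite_eq' univ x, if_pos (mem_univ x)]
  ring

/-- Hence the target weight is invariant under the tempered-transition kernel: the chain of
tempered transitions samples `e^{-S 0}/Z 0` exactly. -/
theorem temperedKernel_isStationary {N : ℕ} (S : Fin (N + 1) → X → ℝ)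
    (T Tadj : Fin N → X → X → ℝ) (hT : ∀ i a b, 0 ≤ T i a b) (hTadj : ∀ i a b, 0 ≤ Tadj i a b)
    (hrev : ∀ i : Fin N, MutuallyReversible (fun x => Real.exp (-S i.succ x)) (T i) (Tadj i)) :
    IsStationary (fun x => Real.exp (-S 0 x)) (temperedKernel S T Tadj) :=
  (temperedKernel_detailedBalance S T Tadj hT hTadj hrev).isStationary
    (temperedKernel_sum_eq_one S T Tadj)

end Kernel

end Summit.Ventures.LatticeQCDFlow.Exactness
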